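import Summits.ValiantsHypothesis.ValiantsHypothesis.Theorems.LacunarySymmetroidMatrixDescartesOverlapWindowTwo
import Summits.ValiantsHypothesis.ValiantsHypothesis.Theorems.LacunarySymmetroidMatrixDescartesOverlapSectorLog

/-!
# `MatrixDescartes` — the MIXED-COVER form of the overlap sector: any certified window bounds ⇒ the crux inequality

HONEST FRAMING.  Object-search cell `pub-symmetroid`, crux `Theses.LacunarySymmetroid.MatrixDescartes` (ledger item
`stmt-ValiantsHypothesis-18050`, route `LacunarySymmetroid`; seat `val-sym-mdr-p2`, gen 13).  The crux implies `VP ≠ VNP`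
by the route's assembly; NOTHING here is progress on it, and nothing here is a claim about `VP ≠ VNP`, `DoorA26` /
`DoorA34` or the cell's registers.  Sequel of `…OverlapWindowTwo` (glue `card_posRoots_le_of_windowBounds`) and
`…OverlapSectorLog` (`sector_absorb_log`).

THE POINT.  The cell now has several window laws with different currencies and costs — Rouché two-letter windows (gen 12,
`m`), Loewner regime windows (gen 4, `m`), one-survivor / two-survivor overlap windows (`#E_L − 1`, `#E_L − 2 (+1)`), rank-one
windows (`D(m−1,K−1) − 1`), dominance / coefficient rays (`0`) — and ONE way to spend them on the crux: cover the positive axis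
of `F` AND of its reflection `F(−X)` (letters `(−1)^(d l) S l`) by chains of windows with certified bounds `B j`, `B' j` and
root-free rays; then `Z ≤ ∑ B j + ∑ B' j + 1` (`card_realRoots_le_of_windowBounds`, tree `stub_negRoots`), and in the crux's
regime any total `∑ B j + ∑ B' j ≤ 2K(m+w)^w` with `w ≤ ⌊log₂ K⌋` gives `Z^q ≤ 2^(K⌊log₂K⌋)` (`mixedCover_mdr`).  Pure glue; no
new analysis.  [folklore]
-/

-- `Summit.ValiantsHypothesis.ValiantsHypothesis.…` repeats a component by the D-0017 layout (single-conjunct summit).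
set_option linter.dupNamespace false

namespace Summit.ValiantsHypothesis.ValiantsHypothesis.Theorems.LacunarySymmetroidMatrixDescartes.Overlap

open Polynomial Finset Set
open scoped BigOperators Matrix

variable {K m : ℕ}

/-! ## §22 Mixed covers -/

/-- **All real zeros from two certified covers.**  Window bounds `B` on a chain `p` for `F` and `B'` on a chain `p'` for the
reflected pencil `S l ↦ (−1)^(d l) S l`, with root-free rays for both, give `Z ≤ ∑ B j + ∑ B' j + 1`. [folklore] -/
theorem card_realRoots_le_of_windowBounds (d : Fin K → ℕ) (S : Fin K → Matrix (Fin m) (Fin m) ℝ) {N N' : ℕ}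
    (p : Fin (N + 1) → ℝ) (B : Fin N → ℕ) (p' : Fin (N' + 1) → ℝ) (B' : Fin N' → ℕ)
    (hwin : ∀ j, ((Matrix.det (∑ l, ((X : ℝ[X]) ^ d l) • (S l).map C)).roots.toFinset.filter
        (fun x => x ∈ Icc (p j.castSucc) (p j.succ))).card ≤ B j)
    (hbelow : ∀ x : ℝ, 0 < x → x ≤ p 0 → ¬ (Matrix.det (∑ l, ((X : ℝ[X]) ^ d l) • (S l).map C)).IsRoot x)
    (habove : ∀ x : ℝ, p (Fin.last N) ≤ x → ¬ (Matrix.det (∑ l, ((X : ℝ[X]) ^ d l) • (S l).map C)).IsRoot x)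
    (hwin' : ∀ j, ((Matrix.det (∑ l, ((X : ℝ[X]) ^ d l) • (((-1 : ℝ) ^ d l) • S l).map C)).roots.toFinset.filter
        (fun x => x ∈ Icc (p' j.castSucc) (p' j.succ))).card ≤ B' j)
    (hbelow' : ∀ x : ℝ, 0 < x → x ≤ p' 0 →
      ¬ (Matrix.det (∑ l, ((X : ℝ[X]) ^ d l) • (((-1 : ℝ) ^ d l) • S l).map C)).IsRoot x)
    (habove' : ∀ x : ℝ, p' (Fin.last N') ≤ x →
      ¬ (Matrix.det (∑ l, ((X : ℝ[X]) ^ d l) • (((-1 : ℝ) ^ d l) • S l).map C)).IsRoot x) :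
    (Matrix.det (∑ l, ((X : ℝ[X]) ^ d l) • (S l).map C)).roots.toFinset.card ≤ ∑ j, B j + ∑ j, B' j + 1 := by
  have h1 := card_posRoots_le_of_windowBounds d S p B hwin hbelow habove
  have h2 := card_posRoots_le_of_windowBounds d (fun l => ((-1 : ℝ) ^ d l) • S l) p' B' hwin' hbelow' habove'
  have h3 := stub_negRoots K m d S
  omega

/-- **The crux's inequality from a mixed cover.**  In the regime `m ≤ 2^((⌊log₂K⌋+c)^c)`, for `K ≥ K₀(c, q)`: if a real lacunary
pencil and its reflection admit certified window covers (any of the cell's window laws) with root-free rays and total budget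
`∑ B j + ∑ B' j ≤ 2K(m+w)^w` for some `w ≤ ⌊log₂ K⌋`, then `Z^q ≤ 2^(K⌊log₂K⌋)`. [folklore] -/
theorem mixedCover_mdr (c q : ℕ) : ∃ K₀ : ℕ, ∀ K m : ℕ, K₀ ≤ K → m ≤ 2 ^ ((Nat.log 2 K + c) ^ c) →
    ∀ (d : Fin K → ℕ) (S : Fin K → Matrix (Fin m) (Fin m) ℝ) (N N' : ℕ)
      (p : Fin (N + 1) → ℝ) (B : Fin N → ℕ) (p' : Fin (N' + 1) → ℝ) (B' : Fin N' → ℕ),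
      (∀ j, ((Matrix.det (∑ l, ((X : ℝ[X]) ^ d l) • (S l).map C)).roots.toFinset.filter
        (fun x => x ∈ Icc (p j.castSucc) (p j.succ))).card ≤ B j) →
      (∀ x : ℝ, 0 < x → x ≤ p 0 → ¬ (Matrix.det (∑ l, ((X : ℝ[X]) ^ d l) • (S l).map C)).IsRoot x) →
      (∀ x : ℝ, p (Fin.last N) ≤ x → ¬ (Matrix.det (∑ l, ((X : ℝ[X]) ^ d l) • (S l).map C)).IsRoot x) →
      (∀ j, ((Matrix.det (∑ l, ((X : ℝ[X]) ^ d l) • (((-1 : ℝ) ^ d l) • S l).map C)).roots.toFinset.filter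
        (fun x => x ∈ Icc (p' j.castSucc) (p' j.succ))).card ≤ B' j) →
      (∀ x : ℝ, 0 < x → x ≤ p' 0 →
        ¬ (Matrix.det (∑ l, ((X : ℝ[X]) ^ d l) • (((-1 : ℝ) ^ d l) • S l).map C)).IsRoot x) →
      (∀ x : ℝ, p' (Fin.last N') ≤ x →
        ¬ (Matrix.det (∑ l, ((X : ℝ[X]) ^ d l) • (((-1 : ℝ) ^ d l) • S l).map C)).IsRoot x) →
    ∀ w : ℕ, w ≤ Nat.log 2 K → ∑ j, B j + ∑ j, B' j ≤ 2 * (K * (m + w) ^ w) →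
      (Matrix.det (∑ l, ((X : ℝ[X]) ^ d l) • (S l).map C)).roots.toFinset.card ^ q ≤ 2 ^ (K * Nat.log 2 K) := by
  obtain ⟨K₀, hK₀⟩ := sector_absorb_log c q
  refine ⟨K₀, fun K m hK hm d S N N' p B p' B' hwin hbelow habove hwin' hbelow' habove' w hw hbudget =>
    hK₀ K m _ w hK hm hw ?_⟩
  have h := card_realRoots_le_of_windowBounds d S p B p' B' hwin hbelow habove hwin' hbelow' habove'
  omega

end Summit.ValiantsHypothesis.ValiantsHypothesis.Theorems.LacunarySymmetroidMatrixDescartes.Overlap
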